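import Mathlib
import HarnessLib
import Literature.MathematicalPhysics.QuantumFieldTheory.ConstructiveQFTWave0
import Summits.Ventures.LatticeQCDFlow.Scaling.PlaquetteIndependence2D
import Summits.Ventures.LatticeQCDFlow.Scaling.PlaquetteMarginals2D
import Summits.Ventures.LatticeQCDFlow.Scaling.PlaquetteDecorrelationTwoDim

/-!
# LatticeQCDFlow / Scaling — two dimensions, ANY compact gauge group: every PATCH of plaquettes is asymptotically a product of independent one-plaquette laws (finite-dimensional distributions)

HONEST FRAMING: exact (Metropolis-corrected) sampling algorithms for lattice gauge theory; figures of merit are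
autocorrelation/cost numbers at stated couplings and volumes; no continuum-physics claim.

Venture `LatticeQCDFlow` (cell pub-lqcd), topic `Scaling`, FANOUT row 30 (lean-1) — OUR WORK, the patch form of the
one-bad-set expansion of `Scaling/PlaquetteDecorrelationTwoDim.lean` (which treated a PAIR `p ≠ p'`).  For ANY compact
second-countable `G`, any measurable weight `w = c + v` with `v ≤ s`, any finite set `P` of plaquettes of `(ℤ/L)²`
with `#P + 2 ≤ L²` and any family of measurable `Φ_x ≥ 0`, `x ∈ P`:

* `lintegral_pi_patch_prod` — product-law integrals factorise:
  `∫ ∏_{x∈P} Φ_x(g_x) · ∏_{x∈t} v(g_x) dHaar^{⊗Λ} = (∏_{x∈P} m(Φ_x))·m(v)^{#t}` (`t` disjoint from `P`);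
* `lintegral_patch_prod_eq_pi` — a `t`-term with a free puncture `x₀ ∉ t ∪ P` equals its product-law value
  (`PlaquetteMarginals2D.lintegral_comp_plaquettes_eq_pi`);
* `patch_weight_expansion` — `∏_{x∈P}Φ_x(U_x)·∏_x (c + v(U_x)) = Σ_{t ⊆ Λ∖P} c^{#(Λ∖P)−#t}·∏_{x∈P}Φ̂_x(U_x)·∏_{x∈t} v(U_x)`,
  `Φ̂_x = Φ_x·(c + v)`;
* **`patch_lintegral_upper`**, **`patch_lintegral_lower`** — with `a = ∏_{x∈P} m(Φ_x w)`, `y = m(v)`, `k = #P`: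
  `N := ∫ ∏_{x∈P}Φ_x(U_x)·∏_x w(U_x) dHaar^{⊗E} ≤ a·((c+y)^{L²−k} + s·y^{L²−k−1})` and `a·(c+y)^{L²−k} ≤ N + a·y^{L²−k}`.

* `lintegral_prod_weight_two_sandwich` — the empty patch: `(c+y)^{L²} ≤ Z + y^{L²}`, `Z ≤ (c+y)^{L²} + s·y^{L²−1}`
  (the two-dimensional partition function to EXPONENTIAL accuracy, sharper than the one-plaquette sandwich of
  `PlaquetteIndependence2D`; the Wilson specialisation is `Scaling/WilsonPartitionFunctionTwoDim.lean`).

Dividing by the same bounds for the empty family (`N(∅) = Z`; the division is left to the consumer — the pair case is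
carried out in real numbers in `Scaling/WilsonPairCovarianceTwoDim.lean`): every cylinder expectation of the normalised measure
`(∏_x w(U_x))·Haar^{⊗E}/Z` is within the factor `r_{L,k}^{±1}`, `r_{L,k} = (1 − q^{L²−k})/(1 + (s/z)q^{L²−k−1}) → 1`
(`q = y/z = 1 − c/m(w) < 1`), of its value under INDEPENDENT one-plaquette laws `w dHaar/z` — the two-dimensional
plaquette field of every compact gauge group (Wilson weight of any continuous representation at any real coupling,
`Scaling/WilsonPairCovarianceTwoDim.wilson_oneWeight_bounds`) converges to an i.i.d. field in the sense of
finite-dimensional distributions, uniformly in the position of the patch.  NOT CLAIMED: `d ≥ 3`; rates in total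
variation for growing patches.  Literature grade: known (Migdal 1975, Gross–Witten 1980); new = character-free,
kernel-checked, every compact group.  Elementary; nothing here is cited as a fact; no `def`, no `sorry`.
-/

noncomputable section

namespace Summit.Ventures.LatticeQCDFlow.Theory2.Lattice.TwoDim

open MeasureTheory Filter Topology Literature.MathematicalPhysics.QuantumFieldTheory
open scoped ENNReal

variable {L : ℕ} {G : Type*} [Group G] [TopologicalSpace G] [IsTopologicalGroup G] [CompactSpace G]
  [SecondCountableTopology G] [MeasurableSpace G] [BorelSpace G]

/-! ## §1. Product-law integrals of patch-times-bulk observables -/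

omit [SecondCountableTopology G] in
/-- **Product-law integrals factorise** (patch form): for `t` disjoint from `P`,
`∫ ∏_{x∈P} Φ_x(g_x)·∏_{x∈t} v(g_x) dHaar^{⊗Λ} = (∏_{x∈P} m(Φ_x))·m(v)^{#t}`. [folklore] -/
theorem lintegral_pi_patch_prod [NeZero L] (P t : Finset (Site 2 L)) (hPt : Disjoint P t)
    {Φ : Site 2 L → G → ℝ≥0∞} {v : G → ℝ≥0∞} (hΦ : ∀ x, Measurable (Φ x)) (hv : Measurable v) :
    ∫⁻ g, (∏ x ∈ P, Φ x (g x)) * ∏ x ∈ t, v (g x) ∂(Measure.pi fun _ : Site 2 L => haarProbability G) =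
      (∏ x ∈ P, ∫⁻ u, Φ x u ∂(haarProbability G)) * (∫⁻ u, v u ∂(haarProbability G)) ^ t.card := by
  classical
  set F : Site 2 L → G → ℝ≥0∞ := fun i u =>
    (if i ∈ P then Φ i u else 1) * (if i ∈ t then v u else 1) with hF
  have hFm : ∀ i, Measurable (F i) := fun i => (measurable_ite_const (hΦ i)).mul (measurable_ite_const hv)
  have hprod : ∀ g : Site 2 L → G, (∏ x ∈ P, Φ x (g x)) * ∏ x ∈ t, v (g x) = ∏ i, F i (g i) := by
    intro g
    simp only [hF, Finset.prod_mul_distrib]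
    rw [Fintype.prod_extend_by_one, Fintype.prod_extend_by_one]
  have hint : ∀ i, ∫⁻ u, F i u ∂(haarProbability G) =
      (if i ∈ P then ∫⁻ u, Φ i u ∂(haarProbability G) else 1) *
        (if i ∈ t then ∫⁻ u, v u ∂(haarProbability G) else 1) := by
    intro i
    by_cases h1 : i ∈ P
    · have h2 : i ∉ t := Finset.disjoint_left.mp hPt h1
      simp only [hF, h1, h2, if_true, if_false, mul_one]
    · by_cases h2 : i ∈ t
      · simp only [hF, h1, h2, if_false, if_true, one_mul]
      · simp only [hF, h1, h2, if_false, lintegral_const, measure_univ, mul_one]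
  simp_rw [hprod]
  rw [GaussianToolkit.lintegral_fintype_prod_eq_prod (fun _ : Site 2 L => haarProbability G) hFm]
  simp_rw [hint]
  rw [Finset.prod_mul_distrib, Fintype.prod_extend_by_one, Fintype.prod_extend_by_one, Finset.prod_const]

/-! ## §2. Good sets -/

/-- **A `t`-term with a free puncture is its product-law value** (patch form). [folklore] -/
theorem lintegral_patch_prod_eq_pi [NeZero L] (hL : 2 ≤ L) {x₀ : Site 2 L} (P t : Finset (Site 2 L))
    (hx₀t : x₀ ∉ t) (hx₀P : x₀ ∉ P) {Φ : Site 2 L → G → ℝ≥0∞} {v : G → ℝ≥0∞} (hΦ : ∀ x, Measurable (Φ x))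
    (hv : Measurable v) :
    ∫⁻ U, (∏ x ∈ P, Φ x (plaquetteHolonomy U x 0 1)) * ∏ x ∈ t, v (plaquetteHolonomy U x 0 1)
        ∂(Measure.pi fun _ : Edge 2 L => haarProbability G) =
      ∫⁻ g, (∏ x ∈ P, Φ x (g x)) * ∏ x ∈ t, v (g x) ∂(Measure.pi fun _ : Site 2 L => haarProbability G) := by
  have hHm : Measurable fun g : Site 2 L → G => (∏ x ∈ P, Φ x (g x)) * ∏ x ∈ t, v (g x) :=
    (Finset.measurable_prod _ fun i _ => (hΦ i).comp (measurable_pi_apply i)).mul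
      (Finset.measurable_prod _ fun i _ => hv.comp (measurable_pi_apply i))
  have hH : ∀ (g : Site 2 L → G) (u : G),
      (∏ x ∈ P, Φ x (Function.update g x₀ u x)) * ∏ x ∈ t, v (Function.update g x₀ u x) =
        (∏ x ∈ P, Φ x (g x)) * ∏ x ∈ t, v (g x) := by
    intro g u
    have h1 : ∀ x ∈ P, Φ x (Function.update g x₀ u x) = Φ x (g x) := fun x hx => by
      rw [Function.update_of_ne (ne_of_mem_of_not_mem hx hx₀P)]
    have h2 : ∀ x ∈ t, v (Function.update g x₀ u x) = v (g x) := fun x hx => by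
      rw [Function.update_of_ne (ne_of_mem_of_not_mem hx hx₀t)]
    rw [Finset.prod_congr rfl h1, Finset.prod_congr rfl h2]
  exact lintegral_comp_plaquettes_eq_pi hL x₀ (H := fun g => (∏ x ∈ P, Φ x (g x)) * ∏ x ∈ t, v (g x)) hHm hH

/-! ## §3. The one-bad-set expansion for a patch -/

/-- The bulk `Λ ∖ P` of a patch. [folklore] -/
theorem patch_bulk_card [NeZero L] (P : Finset (Site 2 L)) : (Finset.univ \ P).card = L ^ 2 - P.card := by
  rw [Finset.card_sdiff_of_subset (Finset.subset_univ _), Finset.card_univ, Fintype.card_fun, ZMod.card,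
    Fintype.card_fin]

omit [Group G] [TopologicalSpace G] [IsTopologicalGroup G] [CompactSpace G] [SecondCountableTopology G]
  [MeasurableSpace G] [BorelSpace G] in
/-- The weight as bulk expansion (patch form):
`∏_{x∈P}Φ_x(g_x)·∏_x(c + v(g_x)) = Σ_{t ⊆ Λ∖P} c^{#(Λ∖P)−#t}·∏_{x∈P}(Φ_x(g_x)(c+v(g_x)))·∏_{x∈t} v(g_x)`. [folklore] -/
theorem patch_weight_expansion [NeZero L] (P : Finset (Site 2 L)) (c : ℝ≥0∞) (v : G → ℝ≥0∞)
    (Φ : Site 2 L → G → ℝ≥0∞) (g : Site 2 L → G) :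
    (∏ x ∈ P, Φ x (g x)) * ∏ x, (c + v (g x)) =
      ∑ t ∈ (Finset.univ \ P).powerset,
        c ^ ((Finset.univ \ P).card - t.card) *
          ((∏ x ∈ P, Φ x (g x) * (c + v (g x))) * ∏ x ∈ t, v (g x)) := by
  classical
  set B := Finset.univ \ P with hB
  have hsplit : ∏ x, (c + v (g x)) = (∏ x ∈ P, (c + v (g x))) * ∏ x ∈ B, (c + v (g x)) := by
    rw [← Finset.prod_union (Finset.disjoint_sdiff), Finset.union_sdiff_of_subset (Finset.subset_univ P)]
  have hexp : ∏ x ∈ B, (c + v (g x)) = ∑ t ∈ B.powerset, c ^ (B.card - t.card) * ∏ x ∈ t, v (g x) := by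
    have h1 : ∏ x ∈ B, (c + v (g x)) = ∏ x ∈ B, (v (g x) + c) :=
      Finset.prod_congr rfl fun x _ => add_comm _ _
    rw [h1, Finset.prod_add]
    refine Finset.sum_congr rfl fun t ht => ?_
    rw [Finset.prod_const, Finset.card_sdiff_of_subset (Finset.mem_powerset.mp ht), mul_comm]
  rw [hsplit, hexp, ← mul_assoc, ← Finset.prod_mul_distrib]
  simp only [Finset.mul_sum]
  refine Finset.sum_congr rfl fun t _ => ?_
  ring

/-- **PATCH INTEGRAL, UPPER BOUND** (2-d, any compact `G`, `L ≥ 2`, weight `w = c + v` with `v ≤ s`, patch `P` with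
`#P + 2 ≤ L²`, `Φ_x ≥ 0` measurable): with `a = ∏_{x∈P} m(Φ_x w)`, `y = m(v)`, `k = #P`,
`∫ ∏_{x∈P}Φ_x(U_x)·∏_x w(U_x) dHaar^{⊗E} ≤ a·((c + y)^{L²−k} + s·y^{L²−k−1})`. [folklore] -/
theorem patch_lintegral_upper [NeZero L] (hL : 2 ≤ L) (P : Finset (Site 2 L)) (hP : P.card + 2 ≤ L ^ 2)
    (c : ℝ≥0∞) {v : G → ℝ≥0∞} {Φ : Site 2 L → G → ℝ≥0∞} (hv : Measurable v) (hΦ : ∀ x, Measurable (Φ x))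
    {s : ℝ≥0∞} (hs : ∀ u, v u ≤ s) :
    ∫⁻ U, (∏ x ∈ P, Φ x (plaquetteHolonomy U x 0 1)) * ∏ x, (c + v (plaquetteHolonomy U x 0 1))
        ∂(Measure.pi fun _ : Edge 2 L => haarProbability G) ≤
      (∏ x ∈ P, ∫⁻ u, Φ x u * (c + v u) ∂(haarProbability G)) *
        ((c + ∫⁻ u, v u ∂(haarProbability G)) ^ (L ^ 2 - P.card) +
          s * (∫⁻ u, v u ∂(haarProbability G)) ^ (L ^ 2 - P.card - 1)) := by
  classical
  set B := Finset.univ \ P with hB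
  have hBcard : B.card = L ^ 2 - P.card := patch_bulk_card P
  have hPB : Disjoint P B := Finset.disjoint_sdiff
  set a := ∏ x ∈ P, ∫⁻ u, Φ x u * (c + v u) ∂(haarProbability G) with ha
  set y := ∫⁻ u, v u ∂(haarProbability G) with hy
  have hw : Measurable fun u => c + v u := measurable_const.add hv
  have hΦw : ∀ x, Measurable fun u => Φ x u * (c + v u) := fun x => (hΦ x).mul hw
  have hBne : B.Nonempty := by rw [← Finset.card_pos, hBcard]; omega
  obtain ⟨x₀, hx₀⟩ := hBne
  have hx₀P : x₀ ∉ P := fun h => Finset.disjoint_left.mp hPB h hx₀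
  set T : Finset (Site 2 L) → ℝ≥0∞ := fun t =>
    ∫⁻ U, (∏ x ∈ P, Φ x (plaquetteHolonomy U x 0 1) * (c + v (plaquetteHolonomy U x 0 1))) *
      ∏ x ∈ t, v (plaquetteHolonomy U x 0 1) ∂(Measure.pi fun _ : Edge 2 L => haarProbability G) with hT
  have hmeasT : ∀ t : Finset (Site 2 L), Measurable fun U : GaugeConfig 2 L G =>
      (∏ x ∈ P, Φ x (plaquetteHolonomy U x 0 1) * (c + v (plaquetteHolonomy U x 0 1))) *
      ∏ x ∈ t, v (plaquetteHolonomy U x 0 1) := fun t =>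
    (Finset.measurable_prod _ fun i _ => (hΦw i).comp (measurable_plaquetteHolonomy i)).mul
      (Finset.measurable_prod _ fun i _ => hv.comp (measurable_plaquetteHolonomy i))
  have hN : ∫⁻ U, (∏ x ∈ P, Φ x (plaquetteHolonomy U x 0 1)) * ∏ x, (c + v (plaquetteHolonomy U x 0 1))
        ∂(Measure.pi fun _ : Edge 2 L => haarProbability G) = ∑ t ∈ B.powerset, c ^ (B.card - t.card) * T t := by
    have h1 : ∀ U : GaugeConfig 2 L G, (∏ x ∈ P, Φ x (plaquetteHolonomy U x 0 1)) *
        ∏ x, (c + v (plaquetteHolonomy U x 0 1)) = ∑ t ∈ B.powerset, c ^ (B.card - t.card) *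
          ((∏ x ∈ P, Φ x (plaquetteHolonomy U x 0 1) * (c + v (plaquetteHolonomy U x 0 1))) *
          ∏ x ∈ t, v (plaquetteHolonomy U x 0 1)) := fun U =>
      patch_weight_expansion P c v Φ (fun x => plaquetteHolonomy U x 0 1)
    simp_rw [h1]
    rw [lintegral_finsetSum _ fun t _ => (hmeasT t).const_mul _]
    refine Finset.sum_congr rfl fun t _ => ?_
    rw [lintegral_const_mul _ (hmeasT t)]
  have hgood : ∀ t ∈ B.powerset, t ≠ B → T t = a * y ^ t.card := by
    intro t ht hne
    have hsub : t ⊆ B := Finset.mem_powerset.mp ht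
    obtain ⟨x₁, hx₁B, hx₁t⟩ := Finset.exists_of_ssubset (Finset.ssubset_iff_subset_ne.mpr ⟨hsub, hne⟩)
    have hx₁P : x₁ ∉ P := fun h => Finset.disjoint_left.mp hPB h hx₁B
    rw [hT]
    simp only
    rw [lintegral_patch_prod_eq_pi hL P t hx₁t hx₁P hΦw hv,
      lintegral_pi_patch_prod P t (hPB.mono_right hsub) hΦw hv]
  have hbad : T B ≤ s * (a * y ^ (L ^ 2 - P.card - 1)) := by
    have hsub : B.erase x₀ ⊆ B := Finset.erase_subset _ _
    have hcard : (B.erase x₀).card = L ^ 2 - P.card - 1 := by rw [Finset.card_erase_of_mem hx₀, hBcard]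
    have hpt : ∀ U : GaugeConfig 2 L G,
        (∏ x ∈ P, Φ x (plaquetteHolonomy U x 0 1) * (c + v (plaquetteHolonomy U x 0 1))) *
          ∏ x ∈ B, v (plaquetteHolonomy U x 0 1) ≤
        s * ((∏ x ∈ P, Φ x (plaquetteHolonomy U x 0 1) * (c + v (plaquetteHolonomy U x 0 1))) *
          ∏ x ∈ B.erase x₀, v (plaquetteHolonomy U x 0 1)) := by
      intro U
      rw [← Finset.mul_prod_erase B (fun x => v (plaquetteHolonomy U x 0 1)) hx₀]
      set X := ∏ x ∈ P, Φ x (plaquetteHolonomy U x 0 1) * (c + v (plaquetteHolonomy U x 0 1))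
      set Q := ∏ x ∈ B.erase x₀, v (plaquetteHolonomy U x 0 1)
      calc X * (v (plaquetteHolonomy U x₀ 0 1) * Q) = v (plaquetteHolonomy U x₀ 0 1) * (X * Q) := by ring
        _ ≤ s * (X * Q) := mul_le_mul_left (hs _) _
    have hgoodE : T (B.erase x₀) = a * y ^ (L ^ 2 - P.card - 1) := by
      rw [hT]
      simp only
      rw [lintegral_patch_prod_eq_pi hL P (B.erase x₀) (Finset.notMem_erase x₀ B) hx₀P hΦw hv,
        lintegral_pi_patch_prod P (B.erase x₀) (hPB.mono_right hsub) hΦw hv, hcard]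
    calc T B ≤ ∫⁻ U, s * ((∏ x ∈ P, Φ x (plaquetteHolonomy U x 0 1) * (c + v (plaquetteHolonomy U x 0 1))) *
          ∏ x ∈ B.erase x₀, v (plaquetteHolonomy U x 0 1)) ∂(Measure.pi fun _ : Edge 2 L => haarProbability G) :=
          lintegral_mono fun U => hpt U
      _ = s * T (B.erase x₀) := by rw [lintegral_const_mul _ (hmeasT _)]
      _ = _ := by rw [hgoodE]
  have hBmem : B ∈ B.powerset := Finset.mem_powerset.mpr (Finset.Subset.refl _)
  have hbinom : ∑ t ∈ B.powerset, c ^ (B.card - t.card) * (a * y ^ t.card) = a * (c + y) ^ (L ^ 2 - P.card) := by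
    rw [← hBcard, add_comm c y, ← Finset.sum_pow_mul_eq_add_pow y c B, Finset.mul_sum]
    refine Finset.sum_congr rfl fun t _ => ?_
    ring
  rw [hN]
  calc ∑ t ∈ B.powerset, c ^ (B.card - t.card) * T t
      ≤ ∑ t ∈ B.powerset, (c ^ (B.card - t.card) * (a * y ^ t.card) +
          (if t = B then s * (a * y ^ (L ^ 2 - P.card - 1)) else 0)) := by
        refine Finset.sum_le_sum fun t ht => ?_
        by_cases hte : t = B
        · rw [if_pos hte, hte, Nat.sub_self, pow_zero, one_mul, one_mul]
          exact hbad.trans le_add_self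
        · rw [if_neg hte, add_zero, hgood t ht hte]
    _ = a * (c + y) ^ (L ^ 2 - P.card) + s * (a * y ^ (L ^ 2 - P.card - 1)) := by
        rw [Finset.sum_add_distrib, hbinom, Finset.sum_ite_eq' B.powerset B, if_pos hBmem]
    _ = _ := by ring

/-- **PATCH INTEGRAL, LOWER BOUND**: `a·(c + y)^{L²−k} ≤ ∫ ∏_{x∈P}Φ_x(U_x)·∏_x w(U_x) dHaar^{⊗E} + a·y^{L²−k}`. [folklore] -/
theorem patch_lintegral_lower [NeZero L] (hL : 2 ≤ L) (P : Finset (Site 2 L))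
    (c : ℝ≥0∞) {v : G → ℝ≥0∞} {Φ : Site 2 L → G → ℝ≥0∞} (hv : Measurable v) (hΦ : ∀ x, Measurable (Φ x)) :
    (∏ x ∈ P, ∫⁻ u, Φ x u * (c + v u) ∂(haarProbability G)) *
        (c + ∫⁻ u, v u ∂(haarProbability G)) ^ (L ^ 2 - P.card) ≤
      ∫⁻ U, (∏ x ∈ P, Φ x (plaquetteHolonomy U x 0 1)) * ∏ x, (c + v (plaquetteHolonomy U x 0 1))
          ∂(Measure.pi fun _ : Edge 2 L => haarProbability G) +
        (∏ x ∈ P, ∫⁻ u, Φ x u * (c + v u) ∂(haarProbability G)) *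
          (∫⁻ u, v u ∂(haarProbability G)) ^ (L ^ 2 - P.card) := by
  classical
  set B := Finset.univ \ P with hB
  have hBcard : B.card = L ^ 2 - P.card := patch_bulk_card P
  have hPB : Disjoint P B := Finset.disjoint_sdiff
  set a := ∏ x ∈ P, ∫⁻ u, Φ x u * (c + v u) ∂(haarProbability G) with ha
  set y := ∫⁻ u, v u ∂(haarProbability G) with hy
  have hw : Measurable fun u => c + v u := measurable_const.add hv
  have hΦw : ∀ x, Measurable fun u => Φ x u * (c + v u) := fun x => (hΦ x).mul hw
  set T : Finset (Site 2 L) → ℝ≥0∞ := fun t =>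
    ∫⁻ U, (∏ x ∈ P, Φ x (plaquetteHolonomy U x 0 1) * (c + v (plaquetteHolonomy U x 0 1))) *
      ∏ x ∈ t, v (plaquetteHolonomy U x 0 1) ∂(Measure.pi fun _ : Edge 2 L => haarProbability G) with hT
  have hmeasT : ∀ t : Finset (Site 2 L), Measurable fun U : GaugeConfig 2 L G =>
      (∏ x ∈ P, Φ x (plaquetteHolonomy U x 0 1) * (c + v (plaquetteHolonomy U x 0 1))) *
      ∏ x ∈ t, v (plaquetteHolonomy U x 0 1) := fun t =>
    (Finset.measurable_prod _ fun i _ => (hΦw i).comp (measurable_plaquetteHolonomy i)).mul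
      (Finset.measurable_prod _ fun i _ => hv.comp (measurable_plaquetteHolonomy i))
  have hN : ∫⁻ U, (∏ x ∈ P, Φ x (plaquetteHolonomy U x 0 1)) * ∏ x, (c + v (plaquetteHolonomy U x 0 1))
        ∂(Measure.pi fun _ : Edge 2 L => haarProbability G) = ∑ t ∈ B.powerset, c ^ (B.card - t.card) * T t := by
    have h1 : ∀ U : GaugeConfig 2 L G, (∏ x ∈ P, Φ x (plaquetteHolonomy U x 0 1)) *
        ∏ x, (c + v (plaquetteHolonomy U x 0 1)) = ∑ t ∈ B.powerset, c ^ (B.card - t.card) *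
          ((∏ x ∈ P, Φ x (plaquetteHolonomy U x 0 1) * (c + v (plaquetteHolonomy U x 0 1))) *
          ∏ x ∈ t, v (plaquetteHolonomy U x 0 1)) := fun U =>
      patch_weight_expansion P c v Φ (fun x => plaquetteHolonomy U x 0 1)
    simp_rw [h1]
    rw [lintegral_finsetSum _ fun t _ => (hmeasT t).const_mul _]
    refine Finset.sum_congr rfl fun t _ => ?_
    rw [lintegral_const_mul _ (hmeasT t)]
  have hgood : ∀ t ∈ B.powerset, t ≠ B → T t = a * y ^ t.card := by
    intro t ht hne
    have hsub : t ⊆ B := Finset.mem_powerset.mp ht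
    obtain ⟨x₁, hx₁B, hx₁t⟩ := Finset.exists_of_ssubset (Finset.ssubset_iff_subset_ne.mpr ⟨hsub, hne⟩)
    have hx₁P : x₁ ∉ P := fun h => Finset.disjoint_left.mp hPB h hx₁B
    rw [hT]
    simp only
    rw [lintegral_patch_prod_eq_pi hL P t hx₁t hx₁P hΦw hv,
      lintegral_pi_patch_prod P t (hPB.mono_right hsub) hΦw hv]
  have hBmem : B ∈ B.powerset := Finset.mem_powerset.mpr (Finset.Subset.refl _)
  have hbinom : ∑ t ∈ B.powerset, c ^ (B.card - t.card) * (a * y ^ t.card) = a * (c + y) ^ (L ^ 2 - P.card) := by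
    rw [← hBcard, add_comm c y, ← Finset.sum_pow_mul_eq_add_pow y c B, Finset.mul_sum]
    refine Finset.sum_congr rfl fun t _ => ?_
    ring
  have hsum : ∑ t ∈ B.powerset.erase B, c ^ (B.card - t.card) * (a * y ^ t.card) =
      ∑ t ∈ B.powerset.erase B, c ^ (B.card - t.card) * T t :=
    Finset.sum_congr rfl fun t ht => by
      rw [hgood t (Finset.mem_of_mem_erase ht) (Finset.ne_of_mem_erase ht)]
  rw [hN, ← hbinom, ← Finset.sum_erase_add _ _ hBmem,
    ← Finset.sum_erase_add B.powerset (fun t => c ^ (B.card - t.card) * T t) hBmem, hsum,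
    Nat.sub_self, pow_zero, one_mul, one_mul, hBcard]
  have hfin : ∑ t ∈ B.powerset.erase B, c ^ (L ^ 2 - P.card - t.card) * T t ≤
      ∑ t ∈ B.powerset.erase B, c ^ (L ^ 2 - P.card - t.card) * T t + T B := le_self_add
  exact add_le_add_left hfin _

/-- **THE TWO-DIMENSIONAL PARTITION FUNCTION TO EXPONENTIAL ACCURACY** (empty patch): for any weight
`w = c + v` with `v ≤ s` on `(ℤ/L)²`, `L ≥ 2`, `Z = ∫ ∏_x w(U_x) dHaar^{⊗E}` satisfies
`(c + y)^{L²} ≤ Z + y^{L²}` and `Z ≤ (c + y)^{L²} + s·y^{L²−1}` (`y = m(v)`), i.e. `Z = m(w)^{L²}·(1 + O((y/m(w))^{L²−1}))` —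
sharper than the one-plaquette sandwich of `PlaquetteIndependence2D.partitionFunction_two_le` /
`le_partitionFunction_two`. [folklore] -/
theorem lintegral_prod_weight_two_sandwich [NeZero L] (hL : 2 ≤ L) (c : ℝ≥0∞) {v : G → ℝ≥0∞}
    (hv : Measurable v) {s : ℝ≥0∞} (hs : ∀ u, v u ≤ s) :
    (c + ∫⁻ u, v u ∂(haarProbability G)) ^ (L ^ 2) ≤
        ∫⁻ U, ∏ x, (c + v (plaquetteHolonomy U x 0 1)) ∂(Measure.pi fun _ : Edge 2 L => haarProbability G) +
          (∫⁻ u, v u ∂(haarProbability G)) ^ (L ^ 2) ∧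
      ∫⁻ U, ∏ x, (c + v (plaquetteHolonomy U x 0 1)) ∂(Measure.pi fun _ : Edge 2 L => haarProbability G) ≤
        (c + ∫⁻ u, v u ∂(haarProbability G)) ^ (L ^ 2) + s * (∫⁻ u, v u ∂(haarProbability G)) ^ (L ^ 2 - 1) := by
  have h0 : (∅ : Finset (Site 2 L)).card + 2 ≤ L ^ 2 := by
    rw [Finset.card_empty]; nlinarith
  have h1m : ∀ _x : Site 2 L, Measurable fun _u : G => (1 : ℝ≥0∞) := fun _ => measurable_const
  have hU := patch_lintegral_upper hL ∅ h0 c hv h1m hs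
  have hLo := patch_lintegral_lower hL ∅ c hv h1m
  simp only [Finset.prod_empty, one_mul, Finset.card_empty, Nat.sub_zero] at hU hLo
  exact ⟨hLo, hU⟩

end Summit.Ventures.LatticeQCDFlow.Theory2.Lattice.TwoDim

end
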